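import Summits.QuantumFields.YangMills.Theorems.UnitScaleTiltProp8FibreTangent
import Summits.QuantumFields.YangMills.Theorems.UnitScaleTiltProp8EulerLagrangeDeriv
import HarnessLib

/-!
# Route `UnitScaleTilt`, crux K1 child «MinimiserStabilityRegPr» (stmt-QuantumFields-19200), registered stub `stub_prop8` (v5 98cb23610ad721f5; leaf V2
# «[Balaban1985Variational] Prop. 8 at the d = 3 carriers») — sub-lemma V2-EL, part 5a: THE ONE-STEP (0.4)-AVERAGE IN MATRICES ALONG CURVES (preparations for the one-step Euler–Lagrange equation of part 5b) — the one-step fibre `{U : Ū = Ū₀}` of Bałaban's (0.4) block averaging carries, through every small configuration `U₀`, DIFFERENTIABLE curves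
# with arbitrary velocity at any non-central bond and compensating velocities at the central crossing bonds only; hence for a minimiser of the `SU(2)`
# Wilson action over any set containing the germ of that fibre, the exact first variation at a non-central bond is balanced by first variations at the
# central bonds alone: `∃ ξ, ξ(b₀) = D₀U₀(b₀)^*, ξ = 0 off {b₀} ∪ {central bonds}, Lin_{U₀}(ξ) = 0` (`exists_tangent_lin_eq_zero`)

Cell `ym3-torus` ∕ fleet seat `ym-ust-19200-p2` (HUMAN RULING D-0037, YM ladder rung R3), successor g3.  WHERE THIS SITS.  [Balaban1985Variational] p. 300: «We will use
only the fact that they are critical configurations of the functional (5)», (127) p. 297: the variation vanishes «for all δA′ satisfying QδA′ = 0» — print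
obtains the admissible variations from the chart (47) of Sect. C.  THIS FILE obtains them at the lattice level, for ONE (0.4) step, from the tree's exact
corrector (`BlockAvgCorrector.exists_avgFun_eq_of_near`, p448916: any off-central perturbation of a point of the fibre is pulled back into the fibre by
re-solving the central bonds, with a Lipschitz modulus) and the implicit differentiation of parts 3–4 (the re-solved central coordinates are differentiable
at `t = 0` because the guarded fibre map is jointly differentiable with a left-invertible coordinate derivative), and feeds the Euler–Lagrange interface of
part 3 (`lin_eq_zero_of_isMinOn_of_hasDerivAt`).  With part 2's NESTED CRITICALITY (`isCritR2_oneStepSlice`: a k-fold R2-critical configuration of the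
carrier minimises over the one-step slice of its own `(K−1)`-average) this is the criticality equation of [Balaban1985Variational]'s minimisers at the d = 3
carrier in the form Sects. E–F consume: the current `J = D^*F` at every non-central bond is a linear image of the currents at the central bonds (the
Lagrange multipliers of the averaging constraint).  Hypotheses are explicit and k-free: `PlaqSmall t₀ U₀` with `stokesConst·t₀ ≤ |I|⁻¹/1000`.

WHAT IS PROVED (sorry-free, no definition; [folklore] ∕ cited):
* §1 `expMeanLogSU_two_δ`, **`coe_avgFun_of_small`** (`Ū(c) = eml(loops)·U(c)` in `M₂(ℂ)`), **`coe_avgFun_update_centralBond`** (the guarded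
  fibre map in matrices with `eml` over the full index set);
* §2 **`differentiableAt_coe_avgFun`** (the (0.4)-average along a bondwise differentiable family is differentiable);
* §3 `norm_mul_mul_sub_le`, `norm_coe_su2`, `eventually_norm_sub_le_mul_of_differentiableAt`, `norm_smul_conj_star_eq`, `half_mul_norm_le_of_near`,
  **`avgFun_eq_avgFun_update_of_agree`** (locality), `offCentral_ratio_le`, `star_coe_mul_mul_mul_star`.  The theorem itself is part 5b
  (`UnitScaleTiltProp8FibreTangentCurve`, `exists_tangent_lin_eq_zero`).

References: T. Bałaban, CMP 102 (1985) 277–309 [Balaban1985Variational] ((5)–(6) p.278, (26)–(27) p.282, (127) p.297, p.300); CMP 109 (1987) 249–301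
[Balaban1987RG1] ((0.4) p.253).
-/

noncomputable section

open scoped BigOperators Matrix.Norms.L2Operator Matrix
open Filter Topology Asymptotics NormedSpace Function

namespace Summit.QuantumFields.YangMills.Theorems.Prop8Criticality

open Literature.MathematicalPhysics.QuantumFieldTheory.Balaban1983to89
open T4Continuum AveragingRT BlockAveraging BlockAveragingHaarAC BlockAveragingEMLHaarAC ExpMeanLog
open B7TransferAnalyticMean BlockAveragingEMLAnalyticMean
open Summit.QuantumFields.YangMills.Theorems.BlockAvgCorrector (stokesConst stokesConst_nonneg emlWeight_pos emlWeight_le_one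
  norm_openHol_mul_star_sub_one_le plaqSmall_of_forall_norm_sub_le exists_avgFun_eq_of_near)

variable {P : Params} {j : ℕ}

/-! ## §1 The one-step average of `SU(2)` fields in matrices: normal forms on the small-field region -/

section NormalForm

/-- The guard radius of the exp-mean-log average on `SU(2)` is `1/3`. [folklore] -/
theorem expMeanLogSU_two_δ : (expMeanLogSU (n := Fin 2)).δ = 1 / 3 := by
  rw [expMeanLogSU_δ, Fintype.card_fin]
  refine min_eq_left ?_
  have := Real.pi_gt_three
  rw [show ((2 : ℕ) : ℝ) = 2 by norm_num]
  linarith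

/-- **THE (0.4)-AVERAGE IN MATRICES ON THE SMALL-FIELD REGION**: if every loop variable of `U` at `c` is within `1/3` of the identity, then
`Ū(c) = eml(loop variables)·U(c)` read in `M₂(ℂ)` (`U(c)` = the straight transporter). [cite: Balaban1987RG1, (0.4) p.253] -/
theorem coe_avgFun_of_small (U : GaugeField P j (Matrix.specialUnitaryGroup (Fin 2) ℂ)) (c : PBond P (j + 1))
    (hsmall : Small (expMeanLogSU (n := Fin 2)) U c) :
    ((avgFun (expMeanLogSU (n := Fin 2)) U c : Matrix.specialUnitaryGroup (Fin 2) ℂ) : Matrix (Fin 2) (Fin 2) ℂ)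
      = eml (fun i => ((loopHol U c i : Matrix.specialUnitaryGroup (Fin 2) ℂ) : Matrix (Fin 2) (Fin 2) ℂ))
          * ((axialAvg U c : Matrix.specialUnitaryGroup (Fin 2) ℂ) : Matrix (Fin 2) (Fin 2) ℂ) := by
  show (((corr (expMeanLogSU (n := Fin 2)) U c * axialAvg U c : Matrix.specialUnitaryGroup (Fin 2) ℂ)) : Matrix (Fin 2) (Fin 2) ℂ) = _
  unfold corr
  rw [if_pos hsmall, Submonoid.coe_mul, coe_avg_expMeanLogSU _ hsmall, ← eml_eq_exp]

/-- **THE GUARDED FIBRE MAP IN MATRICES**: for `U′ = U[β(c) ↦ g]` with small loop variables at `c`,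
`Ū′(c) = eml(1 | h_i·W^*)·W` with `W = pre·g·post` and `h_i` the off-central open holonomies of `U` — the normal form of
`BlockAveragingEMLHaarAC.avgFun_update_centralBond_self` ∕ `coe_fibreCore_eq`, written with `eml` over the full index set. [cite: Balaban1987RG1, (0.4) p.253] -/
theorem coe_avgFun_update_centralBond [DecidableEq (PBond P j)] (hj : j + 1 ≤ P.m + P.K)
    (U : GaugeField P j (Matrix.specialUnitaryGroup (Fin 2) ℂ)) (c : PBond P (j + 1)) (g : Matrix.specialUnitaryGroup (Fin 2) ℂ)
    (hsmall : Small (expMeanLogSU (n := Fin 2)) (update U (centralBond c) g) c) :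
    ((avgFun (expMeanLogSU (n := Fin 2)) (update U (centralBond c) g) c : Matrix.specialUnitaryGroup (Fin 2) ℂ) : Matrix (Fin 2) (Fin 2) ℂ)
      = eml (fun i => if IsCentral c i then (1 : Matrix (Fin 2) (Fin 2) ℂ) else
            ((openHol U c i : Matrix.specialUnitaryGroup (Fin 2) ℂ) : Matrix (Fin 2) (Fin 2) ℂ)
              * star (((pre U c : Matrix.specialUnitaryGroup (Fin 2) ℂ) : Matrix (Fin 2) (Fin 2) ℂ) * (g : Matrix (Fin 2) (Fin 2) ℂ)
                  * ((post U c : Matrix.specialUnitaryGroup (Fin 2) ℂ) : Matrix (Fin 2) (Fin 2) ℂ)))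
          * (((pre U c : Matrix.specialUnitaryGroup (Fin 2) ℂ) : Matrix (Fin 2) (Fin 2) ℂ) * (g : Matrix (Fin 2) (Fin 2) ℂ)
              * ((post U c : Matrix.specialUnitaryGroup (Fin 2) ℂ) : Matrix (Fin 2) (Fin 2) ℂ)) := by
  have hW : pre U c * g * post U c ∈ fibreGuard (expMeanLogSU (n := Fin 2)) U c := (small_update_centralBond_self_iff hj _ U c g).mp hsmall
  have hW' : ∀ i, dist1 (fibreFamily U c (pre U c * g * post U c) i) < (expMeanLogSU (n := Fin 2)).δ := hW
  rw [avgFun_update_centralBond_self hj, fibreMap_of_mem _ U c hW, Submonoid.coe_mul, coe_avg_expMeanLogSU _ hW', ← eml_eq_exp]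
  congr 1
  · congr 1
    funext i
    by_cases hc : IsCentral c i
    · rw [if_pos hc, fibreFamily_of_isCentral U c _ i hc]; rfl
    · rw [if_neg hc, coe_fibreFamily_of_not_isCentral U c _ i hc, Submonoid.coe_mul, Submonoid.coe_mul]

end NormalForm

/-! ## §2 Differentiability of the one-step average along bondwise differentiable families -/

section AvgDiff

/-- **THE (0.4)-AVERAGE ALONG A BONDWISE DIFFERENTIABLE FAMILY IS DIFFERENTIABLE** (in matrices, at `t = 0`), provided the loop variables stay in the
guard near `t = 0` and are within `1` of the identity at `t = 0` (product rule along the loops + analyticity of the exp-mean-log). [folklore] -/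
theorem differentiableAt_coe_avgFun {Γ : ℝ → GaugeField P j (Matrix.specialUnitaryGroup (Fin 2) ℂ)}
    (hΓ : ∀ b : PBond P j, DifferentiableAt ℝ (fun t : ℝ => (Γ t b : Matrix (Fin 2) (Fin 2) ℂ)) 0) (c : PBond P (j + 1))
    (hsmall : ∀ᶠ t in 𝓝 (0 : ℝ), Small (expMeanLogSU (n := Fin 2)) (Γ t) c)
    (hloop : ∀ i, ‖((loopHol (Γ 0) c i : Matrix.specialUnitaryGroup (Fin 2) ℂ) : Matrix (Fin 2) (Fin 2) ℂ) - 1‖ < 1) :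
    DifferentiableAt ℝ (fun t : ℝ => ((avgFun (expMeanLogSU (n := Fin 2)) (Γ t) c : Matrix.specialUnitaryGroup (Fin 2) ℂ) : Matrix (Fin 2) (Fin 2) ℂ)) 0 := by
  have hF : DifferentiableAt ℝ (fun t : ℝ => eml (fun i => ((loopHol (Γ t) c i : Matrix.specialUnitaryGroup (Fin 2) ℂ) : Matrix (Fin 2) (Fin 2) ℂ))
      * ((axialAvg (Γ t) c : Matrix.specialUnitaryGroup (Fin 2) ℂ) : Matrix (Fin 2) (Fin 2) ℂ)) 0 := by
    refine DifferentiableAt.mul ?_ ?_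
    · have htuple : DifferentiableAt ℝ (fun t : ℝ => fun i => ((loopHol (Γ t) c i : Matrix.specialUnitaryGroup (Fin 2) ℂ) : Matrix (Fin 2) (Fin 2) ℂ)) 0 :=
        differentiableAt_pi.mpr fun i => by
          unfold BlockAveraging.loopHol
          exact differentiableAt_coe_holAt hΓ _
      have heml : DifferentiableAt ℝ (eml : (Idx P → Matrix (Fin 2) (Fin 2) ℂ) → Matrix (Fin 2) (Fin 2) ℂ)
          (fun i => ((loopHol (Γ 0) c i : Matrix.specialUnitaryGroup (Fin 2) ℂ) : Matrix (Fin 2) (Fin 2) ℂ)) :=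
        ((analyticAt_eml hloop).differentiableAt).restrictScalars ℝ
      exact heml.comp (0 : ℝ) htuple
    · simp only [axialAvg_eq_holAt_walk]
      exact differentiableAt_coe_holAt hΓ _
  refine (Filter.EventuallyEq.differentiableAt_iff ?_).mpr hF
  filter_upwards [hsmall] with t ht
  exact coe_avgFun_of_small (Γ t) c ht

end AvgDiff

/-! ## §3 The one-step Euler–Lagrange equation in multiplier form -/

section Tangent

/-- `‖abc − a′b′c′‖ ≤ ‖a − a′‖ + ‖b − b′‖ + ‖c − c′‖` for matrices of norm at most one. [folklore] -/
theorem norm_mul_mul_sub_le {a b c a' b' c' : Matrix (Fin 2) (Fin 2) ℂ} (ha' : ‖a'‖ ≤ 1) (hb : ‖b‖ ≤ 1) (hb' : ‖b'‖ ≤ 1) (hc : ‖c‖ ≤ 1) :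
    ‖a * b * c - a' * b' * c'‖ ≤ ‖a - a'‖ + ‖b - b'‖ + ‖c - c'‖ := by
  have hid : a * b * c - a' * b' * c' = (a - a') * b * c + a' * (b - b') * c + a' * b' * (c - c') := by noncomm_ring
  rw [hid]
  have h1 : ‖(a - a') * b * c‖ ≤ ‖a - a'‖ := by
    calc ‖(a - a') * b * c‖ ≤ ‖a - a'‖ * ‖b‖ * ‖c‖ := (norm_mul_le _ _).trans (mul_le_mul_of_nonneg_right (norm_mul_le _ _) (norm_nonneg _))
      _ ≤ ‖a - a'‖ * 1 * 1 := by gcongr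
      _ = ‖a - a'‖ := by ring
  have h2 : ‖a' * (b - b') * c‖ ≤ ‖b - b'‖ := by
    calc ‖a' * (b - b') * c‖ ≤ ‖a'‖ * ‖b - b'‖ * ‖c‖ := (norm_mul_le _ _).trans (mul_le_mul_of_nonneg_right (norm_mul_le _ _) (norm_nonneg _))
      _ ≤ 1 * ‖b - b'‖ * 1 := by gcongr
      _ = ‖b - b'‖ := by ring
  have h3 : ‖a' * b' * (c - c')‖ ≤ ‖c - c'‖ := by
    calc ‖a' * b' * (c - c')‖ ≤ ‖a'‖ * ‖b'‖ * ‖c - c'‖ := (norm_mul_le _ _).trans (mul_le_mul_of_nonneg_right (norm_mul_le _ _) (norm_nonneg _))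
      _ ≤ 1 * 1 * ‖c - c'‖ := by gcongr
      _ = ‖c - c'‖ := by ring
  calc _ ≤ ‖(a - a') * b * c + a' * (b - b') * c‖ + ‖a' * b' * (c - c')‖ := norm_add_le _ _
    _ ≤ (‖(a - a') * b * c‖ + ‖a' * (b - b') * c‖) + ‖a' * b' * (c - c')‖ := by gcongr; exact norm_add_le _ _
    _ ≤ _ := by linarith

/-- A special unitary has norm one in `M₂(ℂ)`. [folklore] -/
theorem norm_coe_su2 (g : Matrix.specialUnitaryGroup (Fin 2) ℂ) : ‖(g : Matrix (Fin 2) (Fin 2) ℂ)‖ = 1 :=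
  UnitaryModel.norm_of_mem_unitaryGroup (Matrix.specialUnitaryGroup_le_unitaryGroup g.2)

/-- From differentiability at `0` to a linear bound near `0`: `‖f t − f 0‖ ≤ C|t|` eventually. [folklore] -/
theorem eventually_norm_sub_le_mul_of_differentiableAt {f : ℝ → Matrix (Fin 2) (Fin 2) ℂ} (hf : DifferentiableAt ℝ f 0) :
    ∃ C : ℝ, 0 ≤ C ∧ ∀ᶠ t in 𝓝 (0 : ℝ), ‖f t - f 0‖ ≤ C * |t| := by
  have h := hf.hasDerivAt.isBigO_sub
  simp only [sub_zero] at h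
  obtain ⟨C, hC, hb⟩ := h.exists_nonneg
  refine ⟨C, hC, ?_⟩
  filter_upwards [hb.bound] with t ht
  simpa only [Real.norm_eq_abs] using ht

/-- `‖r·(U X^* U)‖ = r‖X‖` for unitary `U` and real `r ≥ 0`. [folklore] -/
theorem norm_smul_conj_star_eq {U : Matrix (Fin 2) (Fin 2) ℂ} (hU : U ∈ Matrix.unitaryGroup (Fin 2) ℂ) (X : Matrix (Fin 2) (Fin 2) ℂ) {r : ℝ} (hr : 0 ≤ r) :
    ‖((r : ℝ) : ℂ) • (U * star X * U)‖ = r * ‖X‖ := by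
  rw [norm_smul, Complex.norm_real, Real.norm_eq_abs, abs_of_nonneg hr, CStarRing.norm_mul_mem_unitary _ hU,
    CStarRing.norm_mem_unitary_mul _ hU, norm_star]

/-- The lower bound behind the left inverse: if `‖A − (X + θ·σ)‖ ≤ 148v‖X‖`, `‖θ·σ‖ = θ‖X‖`, `θ ≤ 1 − κ` and `v ≤ κ/1000`, then `κ/2·‖X‖ ≤ ‖A‖`.
[folklore] -/
theorem half_mul_norm_le_of_near {A X T : Matrix (Fin 2) (Fin 2) ℂ} {θ κ v : ℝ} (hest : ‖A - (X + T)‖ ≤ 148 * v * ‖X‖) (hT : ‖T‖ = θ * ‖X‖)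
    (hθ : θ ≤ 1 - κ) (hv : v ≤ κ / 1000) : κ / 2 * ‖X‖ ≤ ‖A‖ := by
  have hX0 := norm_nonneg X
  have h1 : ‖X‖ - θ * ‖X‖ ≤ ‖X + T‖ := by
    have := norm_sub_le (X + T) T
    rw [add_sub_cancel_right, hT] at this
    linarith
  have h2 : ‖X + T‖ - 148 * v * ‖X‖ ≤ ‖A‖ := by
    have h3 := norm_sub_norm_le (X + T) A
    have h4 : ‖X + T - A‖ = ‖A - (X + T)‖ := by rw [← norm_neg, neg_sub]
    rw [h4] at h3
    linarith
  have e1 : θ * ‖X‖ ≤ (1 - κ) * ‖X‖ := mul_le_mul_of_nonneg_right hθ hX0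
  have e2 : 148 * v * ‖X‖ ≤ 148 * (κ / 1000) * ‖X‖ := by
    have := mul_le_mul_of_nonneg_right hv hX0
    linarith
  -- `κ/2·‖X‖ ≤ (1 − θ)‖X‖ − 148v‖X‖` needs `κ ≤ 1 − θ` and `148v ≤ 148κ/1000`; both sides are linear in the atoms `θ‖X‖`, `v‖X‖`, `κ‖X‖`
  have e3 : κ * ‖X‖ ≤ ‖X‖ - θ * ‖X‖ := by nlinarith
  by_cases hκ0 : 0 ≤ κ
  · have e4 : 148 * (κ / 1000) * ‖X‖ ≤ κ / 2 * ‖X‖ := by nlinarith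
    linarith
  · -- `κ < 0`: the left side is nonpositive
    push Not at hκ0
    have : κ / 2 * ‖X‖ ≤ 0 := by nlinarith
    linarith [norm_nonneg A]

/-- **AGREEMENT OFF THE OTHER CENTRAL BONDS**: if `U′` agrees with `U` at every non-central bond, then the average of `U′` at `c` is the average at `c` of
`U` with ONLY the central bond of `c` replaced by that of `U′` (locality of (0.4): `BlockAveragingHaarAC.isLocal_avgFun`). [cite: Balaban1987RG1, (0.4) p.253] -/
theorem avgFun_eq_avgFun_update_of_agree [DecidableEq (PBond P j)] (hj : j + 1 ≤ P.m + P.K) (ℰ : LoopAverage (Matrix.specialUnitaryGroup (Fin 2) ℂ))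
    (U U' : GaugeField P j (Matrix.specialUnitaryGroup (Fin 2) ℂ)) (c : PBond P (j + 1))
    (hagree : ∀ b : PBond P j, (∀ c' : PBond P (j + 1), centralBond c' ≠ b) → U' b = U b) :
    avgFun ℰ U' c = avgFun ℰ (update U (centralBond c) (U' (centralBond c))) c := by
  classical
  refine T4TriangularPushforward.apply_eq_of_agree (isLocal_avgFun hj ℰ) c ((Finset.univ.erase c).image centralBond) U' _ ?_ ?_
  · intro i hi
    by_cases h : ∃ c', centralBond c' = i
    · obtain ⟨c', rfl⟩ := h
      have hc' : c' ≠ c := by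
        rintro rfl
        exact hi (by rw [update_self])
      exact Finset.mem_image.mpr ⟨c', Finset.mem_erase.mpr ⟨hc', Finset.mem_univ _⟩, rfl⟩
    · push Not at h
      exfalso
      apply hi
      rw [update_of_ne (fun hic => h c hic.symm), hagree i (fun c' hc' => h c' hc')]
  · intro i hi
    obtain ⟨c', hc', rfl⟩ := Finset.mem_image.mp hi
    exact ⟨c', (Finset.mem_erase.mp hc').1, rfl⟩

/-- The off-central fraction of the (0.4) index set at a coarse bond is at most `1 − |I|⁻¹` (there is a central index, `nCentral_pos`). [folklore] -/
theorem offCentral_ratio_le (c : PBond P (j + 1)) :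
    (((Finset.univ.filter fun i => ¬ IsCentral c i).card : ℝ)) / (Fintype.card (Idx P) : ℝ) ≤ 1 - emlWeight P := by
  have hn : (0 : ℝ) < Fintype.card (Idx P) := Nat.cast_pos.mpr Fintype.card_pos
  have hsum := Finset.card_filter_add_card_filter_not (s := (Finset.univ : Finset (Idx P))) (p := IsCentral c)
  have hNc := nCentral_pos c
  rw [nCentral] at hNc
  have hm : (((Finset.univ.filter fun i => ¬ IsCentral c i).card : ℝ)) ≤ (Fintype.card (Idx P) : ℝ) - 1 := by
    have h1 : (Finset.univ.filter fun i => ¬ IsCentral c i).card + 1 ≤ Fintype.card (Idx P) := by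
      rw [← Finset.card_univ, ← hsum]; omega
    have h2 := (Nat.cast_le (α := ℝ)).mpr h1
    push_cast at h2; linarith
  rw [BlockAveragingEMLHaarAC.emlWeight, div_le_iff₀ hn, sub_mul, inv_mul_cancel₀ hn.ne', one_mul]
  exact hm

/-- `p^*(p·x·q)q^* = x` for special unitaries `p, q` (the central bond recovered from its private coordinate). [folklore] -/
theorem star_coe_mul_mul_mul_star (p q : Matrix.specialUnitaryGroup (Fin 2) ℂ) (x : Matrix (Fin 2) (Fin 2) ℂ) :
    star (p : Matrix (Fin 2) (Fin 2) ℂ) * ((p : Matrix (Fin 2) (Fin 2) ℂ) * x * (q : Matrix (Fin 2) (Fin 2) ℂ)) * star (q : Matrix (Fin 2) (Fin 2) ℂ) = x := by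
  have h1 : star (p : Matrix (Fin 2) (Fin 2) ℂ) * (p : Matrix (Fin 2) (Fin 2) ℂ) = 1 := Matrix.mem_unitaryGroup_iff'.mp p.2.1
  have h2 : (q : Matrix (Fin 2) (Fin 2) ℂ) * star (q : Matrix (Fin 2) (Fin 2) ℂ) = 1 := Matrix.mem_unitaryGroup_iff.mp q.2.1
  calc _ = (star (p : Matrix (Fin 2) (Fin 2) ℂ) * (p : Matrix (Fin 2) (Fin 2) ℂ)) * x * ((q : Matrix (Fin 2) (Fin 2) ℂ) * star (q : Matrix (Fin 2) (Fin 2) ℂ)) := by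
        noncomm_ring
    _ = x := by rw [h1, h2, one_mul, mul_one]

end Tangent

end Summit.QuantumFields.YangMills.Theorems.Prop8Criticality

end
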